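import Mathlib
import HarnessLib
import Literature.NumberTheory.LFunctions.ZetaSumEq312
import Literature.NumberTheory.LFunctions.BourgainDecouplingMeanValue
import Literature.NumberTheory.LFunctions.BourgainTheorem4Optimisation

/-!
# Bourgain's Theorem 4 for `F = log`: the named-fact split along the printed proof

Topic `Literature/NumberTheory/LFunctions`. The named fact
`Literature.NumberTheory.LFunctions.Bourgain2017_theorem4_log` (J. Bourgain, *Decoupling,
exponential sums and the Riemann zeta function*, J. Amer. Math. Soc. **30** (2017), Theorem 4,
eq. (3.19), for `F = log`: `|S| ≪ M^{1/2} T^{13/84+ε}` for `T^{17/42} ≤ M ≤ √T`,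
`S = ∑_{M/2 ≤ m ≤ M} e(T log(m/M))`) is split here into the two displayed intermediate results of
§4 of the paper on which its (otherwise fully proved, in this directory) derivation rests:

1. `Literature.NumberTheory.LFunctions.Bourgain2017_corollary3` — NAMED FACT: Corollary 3,
   eq. (2.28), the decoupling mean-value bound `A₆(N; δ, Δ) ≪_ε δ Δ N^{9+ε}` for
   `N⁻² ≤ δ ≤ 1`, `N⁻¹ ≤ Δ ≤ 1`, over the existing definition
   `Literature.NumberTheory.LFunctions.bourgainA6` (`BourgainDecouplingMeanValue.lean`). It is
   equivalent to Theorem 2 (2.12) of the paper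
   (`Literature.NumberTheory.LFunctions.Bourgain2017_corollary3_iff_theorem2`, proved), and is the
   paper's one new input into the Bombieri–Iwaniec–Huxley–Watt method (ℓ²-decoupling, Thm 1 with
   `d = 4` over the Bourgain–Demeter `L⁶` decoupling for the parabola, §§2–3).
2. `Literature.NumberTheory.LFunctions.Bourgain2017_eq316_log` — NAMED FACT: eq. (3.16) for
   `F = log` and `c = 1` in (3.3):
   `|S|⁶ ≪_ε M^{ε} (min{M^{11/2} N R^{-7/2}, M^{11/2} R⁻¹ N^{-1/2}} + (M⁶/N³)(N/R)^{2/3})` for every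
   admissible `N` (`1 < N < M`, `R ≤ N ≤ R²`, `R = ⌈(2M³/(NT))^{1/2}⌉ =
   Literature.NumberTheory.LFunctions.bourgainR 1 M N T`), `M ≤ √T`. In the paper this is
   (3.14) + Huxley's resonance-curve second spacing bound (3.15) ([H1] §7) + Corollary 3; it is the
   only place where Huxley's (3.15) enters.

The assembly `Literature.NumberTheory.LFunctions.Bourgain2017_theorem4_log_holds_of :
Bourgain2017_corollary3 → Bourgain2017_eq316_log → Bourgain2017_theorem4_log` is PROVED from the
tree: Corollary 3 gives (3.12) (`Literature.NumberTheory.LFunctions.ZetaSum.eq312_log_of_corollary3`,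
file `ZetaSumEq312`: the Huxley–Watt reduction (3.4)–(3.7), the double large sieve (3.8), the first
spacing bound (3.10) and the second spacing bound (3.11) are all theorems of this tree), and
(3.12) + (3.16) give Theorem 4
(`Literature.NumberTheory.LFunctions.Bourgain2017_theorem4_log_of_eq312_of_eq316`, file
`BourgainTheorem4Optimisation`: (3.12) ⇒ (3.13) on `[T^{3/7}, √T]`, (3.16) ⇒ (3.17) ⇒ (3.18), and
the gluing of the three ranges before Theorem 4).

Neither child restates the parent: (2.28) is a twelfth-moment mean value over `[0,1]² × [-1,1]²`
with no zeta sum in it; (3.16) is a sixth-power bound with a free parameter `N` whose optimisation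
((3.17)–(3.18)) reaches the exponent `13/84` only on `T^{17/42} ≤ M < T^{3/7}` and is weaker than
(3.19) above `T^{3/7}` (where (3.13) takes over).

## Faithfulness notes

* (2.28) is transcribed exactly as the hypothesis `hC3` used throughout this directory
  (`BourgainDecouplingMeanValue.lean`, "Faithfulness notes"): `∀ ε > 0, ∃ C, ∀ N ≥ 1,
  ∀ δ ∈ [1/N², 1], ∀ Δ ∈ [1/N, 1], A₆(N, δ, Δ) ≤ C δ Δ N^{9+ε}`.
* (3.16) is transcribed exactly as the hypothesis `h316` of
  `Literature.NumberTheory.LFunctions.Bourgain2017_eq318_log_of_eq316` with `c = 1` (for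
  `F = log`, `|F''| ≥ 1` on `[1/2, 1]`, so `c = 1` is admissible in (3.1)/(3.3)); "`≪`" with
  "`T` sufficiently large" is `∀ ε > 0, ∃ C T₀, ∀ T ≥ T₀`, uniform in `M, N` in the stated ranges;
  the standing assumptions of §4 (`M ≤ √T`, `1 < N < M`, `R ≤ N ≤ R²` after (3.3)) are explicit
  hypotheses, which makes the fact weaker than an unrestricted reading.

## References

* J. Bourgain, *Decoupling, exponential sums and the Riemann zeta function*, J. Amer. Math. Soc.
  30 (2017), 205–224, doi:10.1090/jams/860, arXiv:1408.5794 — Theorem 2 (2.12), Corollary 3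
  (2.28); §4 (3.3), (3.12)–(3.19), Theorem 4. [BourgainJAMS2017]
* M. N. Huxley, *Exponential sums and the Riemann zeta function IV*, Proc. London Math. Soc. (3)
  66 (1993), 1–40 — §7, the source of (3.15). [Huxley1993]
* M. N. Huxley, *Resonance curves in the Bombieri–Iwaniec method*, Funct. Approx. Comment. Math.
  32 (2004), 7–49 — the second spacing problem by resonance curves. [Huxley2004]
-/

noncomputable section

open Complex MeasureTheory Finset
open scoped Real

namespace Literature.NumberTheory.LFunctions

/-- NAMED FACT — **Bourgain 2017, Corollary 3, eq. (2.28)** ("Using the notation from [H],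
Theorem 2 implies"): for `1/N² ≤ δ ≤ 1` and `1/N ≤ Δ ≤ 1`,
`A₆(N; δ, Δ) = ∫₀¹∫₀¹∫₋₁¹∫₋₁¹ |∑_{n ≤ N} e(n x₁ + n² x₂ + δ⁻¹(n/N)^{3/2} x₃ + Δ⁻¹(n/N)^{1/2} x₄)|¹² dx
≪ δ Δ N^{9+ε}`, with `A₆ = Literature.NumberTheory.LFunctions.bourgainA6` and the implied
constant depending on `ε` only: for every `ε > 0` there is `C` with
`A₆(N; δ, Δ) ≤ C δ Δ N^{9+ε}` for all `N ≥ 1` and all `δ, Δ` in the printed ranges. Equivalent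
to Theorem 2 (2.12) of the paper by
`Literature.NumberTheory.LFunctions.Bourgain2017_corollary3_iff_theorem2` (proved); its content
is the `ℓ²`-decoupling Theorem 1 (`d = 4`) of the paper over the Bourgain–Demeter `L⁶` decoupling
inequality for the parabola (§§2–3, (1.2)–(2.28)).
Users take `(h : Bourgain2017_corollary3)`. [cite: BourgainJAMS2017, Corollary 3, eq. (2.28)] -/
def Bourgain2017_corollary3 : Prop :=
  ∀ ε : ℝ, 0 < ε → ∃ C : ℝ, ∀ N : ℕ, 1 ≤ N → ∀ δ Δ : ℝ,
    1 / (N : ℝ) ^ 2 ≤ δ → δ ≤ 1 → 1 / (N : ℝ) ≤ Δ → Δ ≤ 1 →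
      bourgainA6 N δ Δ ≤ C * δ * Δ * (N : ℝ) ^ (9 + ε)

/-- NAMED FACT — **Bourgain 2017, §4 eq. (3.16), for `F = log` (and `c = 1` in (3.3)).** "Use of
(3.15) instead of (3.11) gives
`|S|⁶ ≪ min{M^{ε+11/2} N R^{-7/2}, M^{ε+11/2} R⁻¹ N^{-1/2}} + (M^{6+ε}/N³)(N/R)^{2/3}`", where
`S = ∑_{M/2 ≤ m ≤ M} e(T log(m/M))` (`Literature.NumberTheory.LFunctions.bourgainSum Real.log T M`),
`N` is the free length parameter of the Huxley–Watt subdivision (`1 < N < M`) and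
`R = ⌈(2M³/(NT))^{1/2}⌉` (`Literature.NumberTheory.LFunctions.bourgainR 1 M N T`, eq. (3.3)) with
the standing constraints `R ≤ N ≤ R²`, `M ≤ √T` of §4. Rendered: for every `ε > 0` there are
`C, T₀` such that the displayed bound (with `M^{ε}` factored out) holds for all `T ≥ T₀` and all
such `M, N`. In the paper (3.16) is obtained from the reduction (3.4)–(3.8), the first spacing
bound (3.10) (Corollary 3) and Huxley's resonance-curve bound (3.15) for the second spacing
problem ([H1] = Huxley, Proc. LMS (3) 66 (1993), §7) with the choice `V = N/Q` or `V = R⁴/N²`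
((3.14)); (3.17)–(3.18) and the range `T^{17/42} ≤ M < T^{3/7}` of Theorem 4 follow from it
(`Literature.NumberTheory.LFunctions.Bourgain2017_eq318_log_of_eq316`, proved).
Users take `(h : Bourgain2017_eq316_log)`.
[cite: BourgainJAMS2017, §4 eq. (3.16) (with (3.3), (3.14)–(3.15))] -/
def Bourgain2017_eq316_log : Prop :=
  ∀ ε : ℝ, 0 < ε → ∃ C T₀ : ℝ, ∀ T M N : ℝ, T₀ ≤ T → M ≤ Real.sqrt T →
    1 < N → N < M → (bourgainR 1 M N T : ℝ) ≤ N → N ≤ (bourgainR 1 M N T : ℝ) ^ 2 →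
      ‖bourgainSum Real.log T M‖ ^ 6 ≤ C * M ^ ε *
        (min (M ^ (11 / 2 : ℝ) * N / (bourgainR 1 M N T : ℝ) ^ (7 / 2 : ℝ))
            (M ^ (11 / 2 : ℝ) / ((bourgainR 1 M N T : ℝ) * N ^ (1 / 2 : ℝ))) +
          M ^ 6 / N ^ 3 * (N / (bourgainR 1 M N T : ℝ)) ^ (2 / 3 : ℝ))

/-- **Assembly (PROVED): Bourgain's Theorem 4 for `F = log` from Corollary 3 (2.28) and (3.16).**
Corollary 3 gives (3.12) at `N = MT^{-2/7}`
(`Literature.NumberTheory.LFunctions.ZetaSum.eq312_log_of_corollary3`), and (3.12) together with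
(3.16) gives Theorem 4 (`Literature.NumberTheory.LFunctions.Bourgain2017_theorem4_log_of_eq312_of_eq316`
with `c = 1`). [cite: BourgainJAMS2017, Theorem 4, eq. (3.19); §4 (3.12)–(3.18)] -/
theorem Bourgain2017_theorem4_log_holds_of (hC3 : Bourgain2017_corollary3)
    (h316 : Bourgain2017_eq316_log) : Bourgain2017_theorem4_log :=
  Bourgain2017_theorem4_log_of_eq312_of_eq316 one_pos le_rfl (ZetaSum.eq312_log_of_corollary3 hC3)
    h316

end Literature.NumberTheory.LFunctions
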